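import Summits.BirchSwinnertonDyer.BirchSwinnertonDyer.Theorems.PrintCf2RubinValueTwoLinePinClassJunction
import HarnessLib

/-!
# M-LINE-PIN, part 10: THE CLASS JUNCTION IN MÜLLER'S OUTPUT SHAPE — the one-variable datum `D₁` ELIMINATED:
# (Q) + «∀ Λ-dual datum of `H¹_nr(K_∞^{(1)}, A_θ)`: torsion ∧ `(ch)^J = (G₁)`» (verbatim the corollaries of `Muller2020.thm13_exists_nuBranch_charIdeal_eq`)
# + (A) + S3n′ + even class ⟹ `D₂.X` torsion ∧ `a = b` ∧ `(ch_{Λ₂} D₂.X)^J = (G₂)`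

Cell `bsd-print-cf2`, width seat `bsd-line-cf2c-w8` g4 (prover-bsd-line-cf2c-w8-g4-0), planner g19's named piece M-LINE-PIN (crux child
stmt-BirchSwinnertonDyer-24086 `MainConjClauseAtSplitTwoQuad`). Sequel of part 9 (`…LinePinClassJunction`): the Greenberg–Vatsal datum `D₁` on the
`v`-line is SUPPLIED internally (`KellerYin2024.unrDualData κ₁ v̄ ∅`, the character group `Hom(H¹_nr(K_∞^{(1)}, A_θ), ℚ/ℤ)` with `T = γ₁ − 1`), and
`G₁ ≠ 0` is DERIVED (torsion ⟹ `ch ≠ 0`, `Module.charIdeal_ne_bot`; `J` injective), so the print input (M) enters in EXACTLY the shape of the typed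
corollaries `Muller2020.thm13_exists_nuBranch_charIdeal_eq.finite_and_isTorsion` / `.exists_span_eq`: «for every `D₁ : DatumDualData κ₁ γ₁ A_θ (bdpData _ 2 v̄) ∅`,
`D₁.X` is torsion and `(ch_Λ D₁.X).map (map J) = (G₁)`». `--supports stmt-BirchSwinnertonDyer-24086 --as helper`, Theses-free. HONEST FRAMING: assembly;
displayed inputs: (Q) `hQ`, (M) `hM` (+ Müller's `hθκ`), `J` injective, (A) `hA` (exponent `e`), S3n′ `hfin`, even class `hI`, `κ₂` unramified outside
`v̄ ∣ 2`, a Frobenius lift `τ ∈ D_v̄` with `κ₁ τ = κ₁ γ₁` acting as `u`, `2 ∣ u − 1`. No summit statement is proved by this seat; BSD is not proved by any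
of this. THEOREMS ONLY (no definition, no named fact, no `sorry`).

* `ne_zero_of_isTorsion_of_map_charIdeal_eq_span` — `X` torsion (any `Λ`-module), `J` injective, `(ch_Λ X).map (map J) = (G)` ⟹ `G ≠ 0`.
* `isTorsion_and_eq_and_map_charIdeal_eq_span_of_powForm_charModule_of_line` — THE CLASS JUNCTION in Müller's output shape;
  `…_of_line_of_mem_decomp` — Frobenius-adapted form (`τ := γ₁`).
presearch: as part 9 — assembly of tree theorems. beyond-print theorem: no.

References: [GreenbergVatsal2000] §2; [GreenbergLNM1716] §3–4; [Washington1997] §13.2; [deShalit1987] II.4.12; [Mueller2020MCSplitTwo] Thm. 1.3;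
[KellerYin2024] §1.1–1.2.
-/

noncomputable section

open scoped Classical Pointwise AddSubgroup NumberField

-- the summit namespace `Summit.BirchSwinnertonDyer.BirchSwinnertonDyer` repeats the problem name by design (D-0017)
set_option linter.dupNamespace false
set_option autoImplicit false

open NumberField IsDedekindDomain Field Literature.NumberTheory.GaloisRepresentations
  Literature.NumberTheory.EllipticCurves Literature.NumberTheory.EllipticCurves.Module
  Literature.NumberTheory.EllipticCurves.IwasawaAlgebra Literature.NumberTheory.EllipticCurves.GreenbergSelmer
  Literature.NumberTheory.EllipticCurves.GreenbergVatsal2000 Literature.NumberTheory.EllipticCurves.KellerYin2024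
  Literature.NumberTheory.EllipticCurves.IwasawaDual
open Summit.BirchSwinnertonDyer.BirchSwinnertonDyer.Theorems.PrintCf2

namespace Summit.BirchSwinnertonDyer.BirchSwinnertonDyer.Theorems.PrintCf2.LinePin

/-! ## §1. `G ≠ 0` from torsion and the identity after an injective coefficient change -/

section NeZero

variable {p : ℕ} [Fact p.Prime]

/-- `(ch_Λ X).map (map J) = (G)` with `J` injective ⟹ `G ≠ 0` (`ch_Λ X ≠ 0` for every module, `Module.charIdeal_ne_bot`). [folklore] -/
theorem ne_zero_of_map_charIdeal_eq_span (X : Type*) [AddCommGroup X] [Module (IwasawaAlgebra p) X]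
    {S : Type*} [CommRing S] {J : ℤ_[p] →+* S} (hJ : Function.Injective J) {G : PowerSeries S}
    (hM : (charIdeal (IwasawaAlgebra p) X).map (PowerSeries.map J) = Ideal.span {G}) : G ≠ 0 := by
  intro h0
  rw [h0, Ideal.span_singleton_eq_bot.mpr rfl, Ideal.map_eq_bot_iff_of_injective (PowerSeries.map_injective J hJ)] at hM
  exact Module.charIdeal_ne_bot (IwasawaAlgebra p) X hM

end NeZero

/-! ## §2. The class junction in Müller's output shape -/

section Junction

variable {K : Type} [Field K] [NumberField K]

/-- **M-LINE-PIN, THE CLASS JUNCTION — MÜLLER'S OUTPUT SHAPE** (any number field `K`, `p = 2`). As part 9's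
`isTorsion_and_eq_and_map_charIdeal_eq_span_of_powForm_charModule`, but the one-variable dual datum is internal and (M) is the hypothesis
`hM : ∀ D₁ : DatumDualData κ₁ γ₁ A_θ (bdpData _ 2 v̄) ∅, IsTorsion Λ D₁.X ∧ (ch_Λ D₁.X).map (map J) = (G₁)` (for an injective `J`) — literally what
`Muller2020.thm13_exists_nuBranch_charIdeal_eq` delivers through `.finite_and_isTorsion` and `.exists_span_eq`. Conclusion: **`D₂.X` torsion, `a = b`,
`(ch_{Λ₂} D₂.X).map (map (map J)) = (G₂)`.** [cite: GreenbergVatsal2000, §2 Prop. (2.4)] [cite: GreenbergLNM1716, §3–4] [cite: Washington1997, §13.2]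
[cite: deShalit1987, II.4.12] [cite: Mueller2020MCSplitTwo, Thm. 1.3] [cite: KellerYin2024, §1.2] -/
theorem isTorsion_and_eq_and_map_charIdeal_eq_span_of_powForm_charModule_of_line
    {vbar : HeightOneSpectrum (𝓞 K)} (hvbar : ((2 : ℕ) : 𝓞 K) ∈ vbar.asIdeal)
    {κ₁ κ₂ : ZpExtension K 2} (hκ₂ : κ₂.IsUnramifiedOutside vbar)
    {γ₁ γ₂ : absoluteGaloisGroup K} (hγ : ZpExtension.IsTopGeneratorPair κ₁ κ₂ γ₁ γ₂)
    (θ : FramedGaloisRep K (padicCoeffIntegers (∅ : Set (PadicAlgCl 2))) 1) (hθ2 : ∀ σ : absoluteGaloisGroup K, θ σ ^ 2 = 1)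
    (hθκ : ∃ σ ∈ κ₁.kerSubgroup, θ σ ≠ 1)
    (hI : ∀ y : absoluteGaloisGroup K, y ∈ ZpExtension.pairKer κ₁ κ₂ → y ∈ inertia vbar →
      ∀ m : charModule (∅ : Set (PadicAlgCl 2)) θ, y • m = m)
    {τ : absoluteGaloisGroup K} (hτ : τ ∈ decomp vbar) (hκτ : κ₁ τ = κ₁ γ₁) {u : ℤ}
    (hu : ∀ m : charModule (∅ : Set (PadicAlgCl 2)) θ, τ • m = u • m) (hpu : (2 : ℤ) ∣ u - 1)
    (D₂ : DualData₂ κ₁ κ₂ (charModule (∅ : Set (PadicAlgCl 2)) θ) vbar γ₁ γ₂)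
    (hfin : ∀ N : Submodule (IwasawaAlgebra₂ 2) D₂.X, Module.IsPseudoNull (IwasawaAlgebra₂ 2) N → Finite N)
    {J : ℤ_[2] →+* PadicComplexInt 2} (hJ : Function.Injective J) {G₁ : PowerSeries (PadicComplexInt 2)}
    (hM : ∀ D₁ : DatumDualData κ₁ γ₁ (charModule (∅ : Set (PadicAlgCl 2)) θ)
        (Castella2018.AcSelmer.bdpData (charModule (∅ : Set (PadicAlgCl 2)) θ) 2 vbar) ∅,
      Module.IsTorsion (IwasawaAlgebra 2) D₁.X ∧ (charIdeal (IwasawaAlgebra 2) D₁.X).map (PowerSeries.map J) = Ideal.span {G₁})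
    (G₂ : PowerSeries (PowerSeries (PadicComplexInt 2))) (F : IwasawaAlgebra₂ 2)
    (hF : charIdeal (IwasawaAlgebra₂ 2) D₂.X = Ideal.span {F})
    {a b : ℕ} (hQ : Ideal.span ({((2 : ℕ) : PowerSeries (PowerSeries (PadicComplexInt 2))) ^ a *
        PowerSeries.map (PowerSeries.map J) F} : Set (PowerSeries (PowerSeries (PadicComplexInt 2)))) =
      Ideal.span {((2 : ℕ) : PowerSeries (PowerSeries (PadicComplexInt 2))) ^ b * G₂})
    {e : ℕ} (hA : Ideal.span ({PowerSeries.map (PowerSeries.constantCoeff (R := PadicComplexInt 2)) G₂} : Set (PowerSeries (PadicComplexInt 2))) =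
      Ideal.span {((1 : PowerSeries (PadicComplexInt 2)) + PowerSeries.X) - (u : PowerSeries (PadicComplexInt 2))} ^ e *
        Ideal.span {G₁}) :
    Module.IsTorsion (IwasawaAlgebra₂ 2) D₂.X ∧ a = b ∧
      (charIdeal (IwasawaAlgebra₂ 2) D₂.X).map (PowerSeries.map (PowerSeries.map J)) = Ideal.span {G₂} := by
  have hprim : ∀ m : charModule (∅ : Set (PadicAlgCl 2)) θ, ∃ k : ℕ, 2 ^ k • m = 0 :=
    fun m ↦ exists_pow_smul_cofree_eq_zero (∅ : Set (PadicAlgCl 2)) θ m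
  have hstab : ∀ m : charModule (∅ : Set (PadicAlgCl 2)) θ,
      IsOpen (MulAction.stabilizer (absoluteGaloisGroup K) m : Set (absoluteGaloisGroup K)) :=
    fun m ↦ isOpen_stabilizer_cofree (∅ : Set (PadicAlgCl 2)) θ m
  -- the one-variable datum on the line: the character group of `H¹_nr(K_∞^{(1)}, A_θ)` with `T = γ₁ − 1`
  let D₁ : DatumDualData κ₁ γ₁ (charModule (∅ : Set (PadicAlgCl 2)) θ)
      (Castella2018.AcSelmer.bdpData (charModule (∅ : Set (PadicAlgCl 2)) θ) 2 vbar) ∅ :=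
    unrDualData κ₁ vbar ∅ hprim hstab hγ.left
  obtain ⟨hD₁, hM₁⟩ := hM D₁
  have hG₁ : G₁ ≠ 0 := ne_zero_of_map_charIdeal_eq_span D₁.X hJ hM₁
  exact isTorsion_and_eq_and_map_charIdeal_eq_span_of_powForm_charModule hvbar hκ₂ hγ θ hθ2 hθκ hI hτ hκτ hu hpu D₂ hfin D₁ hD₁ J G₁
    hG₁ hM₁ G₂ F hF hQ hA

/-- **Frobenius-adapted form of the junction in Müller's output shape** (`τ := γ₁ ∈ D_v̄`). [cite: GreenbergVatsal2000, §2 Prop. (2.4)]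
[cite: deShalit1987, II.4.12] [cite: Mueller2020MCSplitTwo, Thm. 1.3] -/
theorem isTorsion_and_eq_and_map_charIdeal_eq_span_of_powForm_charModule_of_line_of_mem_decomp
    {vbar : HeightOneSpectrum (𝓞 K)} (hvbar : ((2 : ℕ) : 𝓞 K) ∈ vbar.asIdeal)
    {κ₁ κ₂ : ZpExtension K 2} (hκ₂ : κ₂.IsUnramifiedOutside vbar)
    {γ₁ γ₂ : absoluteGaloisGroup K} (hγ : ZpExtension.IsTopGeneratorPair κ₁ κ₂ γ₁ γ₂) (hγ₁ : γ₁ ∈ decomp vbar)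
    (θ : FramedGaloisRep K (padicCoeffIntegers (∅ : Set (PadicAlgCl 2))) 1) (hθ2 : ∀ σ : absoluteGaloisGroup K, θ σ ^ 2 = 1)
    (hθκ : ∃ σ ∈ κ₁.kerSubgroup, θ σ ≠ 1)
    (hI : ∀ y : absoluteGaloisGroup K, y ∈ ZpExtension.pairKer κ₁ κ₂ → y ∈ inertia vbar →
      ∀ m : charModule (∅ : Set (PadicAlgCl 2)) θ, y • m = m)
    {u : ℤ} (hu : ∀ m : charModule (∅ : Set (PadicAlgCl 2)) θ, γ₁ • m = u • m) (hpu : (2 : ℤ) ∣ u - 1)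
    (D₂ : DualData₂ κ₁ κ₂ (charModule (∅ : Set (PadicAlgCl 2)) θ) vbar γ₁ γ₂)
    (hfin : ∀ N : Submodule (IwasawaAlgebra₂ 2) D₂.X, Module.IsPseudoNull (IwasawaAlgebra₂ 2) N → Finite N)
    {J : ℤ_[2] →+* PadicComplexInt 2} (hJ : Function.Injective J) {G₁ : PowerSeries (PadicComplexInt 2)}
    (hM : ∀ D₁ : DatumDualData κ₁ γ₁ (charModule (∅ : Set (PadicAlgCl 2)) θ)
        (Castella2018.AcSelmer.bdpData (charModule (∅ : Set (PadicAlgCl 2)) θ) 2 vbar) ∅,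
      Module.IsTorsion (IwasawaAlgebra 2) D₁.X ∧ (charIdeal (IwasawaAlgebra 2) D₁.X).map (PowerSeries.map J) = Ideal.span {G₁})
    (G₂ : PowerSeries (PowerSeries (PadicComplexInt 2))) (F : IwasawaAlgebra₂ 2)
    (hF : charIdeal (IwasawaAlgebra₂ 2) D₂.X = Ideal.span {F})
    {a b : ℕ} (hQ : Ideal.span ({((2 : ℕ) : PowerSeries (PowerSeries (PadicComplexInt 2))) ^ a *
        PowerSeries.map (PowerSeries.map J) F} : Set (PowerSeries (PowerSeries (PadicComplexInt 2)))) =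
      Ideal.span {((2 : ℕ) : PowerSeries (PowerSeries (PadicComplexInt 2))) ^ b * G₂})
    {e : ℕ} (hA : Ideal.span ({PowerSeries.map (PowerSeries.constantCoeff (R := PadicComplexInt 2)) G₂} : Set (PowerSeries (PadicComplexInt 2))) =
      Ideal.span {((1 : PowerSeries (PadicComplexInt 2)) + PowerSeries.X) - (u : PowerSeries (PadicComplexInt 2))} ^ e *
        Ideal.span {G₁}) :
    Module.IsTorsion (IwasawaAlgebra₂ 2) D₂.X ∧ a = b ∧
      (charIdeal (IwasawaAlgebra₂ 2) D₂.X).map (PowerSeries.map (PowerSeries.map J)) = Ideal.span {G₂} :=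
  isTorsion_and_eq_and_map_charIdeal_eq_span_of_powForm_charModule_of_line hvbar hκ₂ hγ θ hθ2 hθκ hI hγ₁ rfl hu hpu D₂ hfin hJ hM G₂ F
    hF hQ hA

end Junction

end Summit.BirchSwinnertonDyer.BirchSwinnertonDyer.Theorems.PrintCf2.LinePin

end
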